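import Summits.QuantumFields.YangMills.Theorems.BalabanUVNodesRateCarriersOfRecord13CoPH
import Summits.QuantumFields.YangMills.Theorems.BalabanUVNodesN17AtSpineCarriers
import Summits.QuantumFields.YangMills.Theorems.BalabanUVNodesN22AtRateRecord12Fixed

/-!
# BalabanUVNodes ∕ node N17 — THE (D4) READ-OUT BINDERS `ReadOutAt D R.u3` AT NODE U3's BUNDLE OF RECORD `u3OfRecord₁₃ θ u k`, REDUCED; THE ZERO-FUNCTIONAL
# TEST; AND WHAT THE (D4)-KEYED U3 SLOTS OF A RESIDUAL READING BOOK — EXACTLY node U2's input triple `Spine.NE4.U2Inputs` on the datum's β (kernel, both directions)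

Cell `pub-ymgap` (HUMAN RULING D-0062 ∕ D-0149 work-bound push, director-ym №197), seat `pub-ymgap-dag-n17-w2` (WIDTH SEAT 2 of 3 on node N17 = NE4), generation 0.
W-SEAT-START-LIST v2∕v3 §2 n17 ITEM 2 (plan g77): «`ReadOutAt D R.u3` ((D4) read-out: `RepresentsA∕B … D.βfun`, `ReadBoundedOn`, `ReadCovariantOn`, sign∕order clauses)
AT THE RECORD u3 `u3OfRecord₁₃ θ … k` — the (D4) conjunct of `PHolderD4`; answers plan's (q3) in substance (does `ReadOutAt` exclude the junk functionals?)».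
THEOREMS ONLY (0 `def`, 0 `sorry`, standard axioms); `--kind proof --supports stmt-QuantumFields-20544 --as helper` (K3⁷ `SpineGivenEndpointR13SepCoPH`); count-neutral.
Imports (T-RATE) layer B at the ₁₃ CoPH home `…RateCarriersOfRecord13CoPH` (brings `u3OfRecord₁₃` and its faces, `RRec₁₃CoPH`, `s_D4_rRec₁₃CoPH_iff`, module 2
`…SpineRates` with `ReadOutAt ∕ N17At ∕ N18At ∕ N22At`, `Node00.Record13CoPH` with `βfun_datumOfRecord₁₃CoPH`, `Node00.RateRecord11` with `U3Objects₁₁ ∕ U3Letters₁₁.Signs`),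
dag-n17-a's companion 6 `…N17AtSpineCarriers` (`YMDAG.N17.u2Inputs_of_readOutAt`) and the N22 lineage's `…N22AtRateRecord12Fixed` (`YMDAG.N22.ne9_of_moduli_le`, NE9 monotone in
the moduli); modifies nothing; every cited lemma used BY NAME.

WHY.  Plan g77's K3⁷ v2 DRAFT (`pub-ymgap-plan/D77-K3V2-draft/`, NOT registered) keys stub 1 on `PHolderD4 β D R := RatesHolderAt D R β ∧ ReadOutAt D R.u3` at THE BUNDLE
OF RECORD `rateCarriersOfRecord₁₃CoPH 𝔯 F θ hP g₀ os (ksel …)`, whose node-U3 component is `u3OfRecord₁₃ θ.toStage13Params (𝔯.lit F θ hP g₀ os).u3 k` with `𝔯` a RESIDUAL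
Stage-13 rate reading (`∃ 𝔯` in `stub_rates13H`).  dag-n18-e's evidence #5 (`K3Stub1ShadowSepCoPH.lean`, `keyedRates_junk`) showed v1's `∃ rr` currency is inhabited by
ZERO U3 functionals on one-point carriers, the residual being N17's scale-shift sentence.  The plan asks (q3): does the added (D4) conjunct exclude such junk?  This file
answers in the kernel:
* §1 (D4) AT THE BUNDLE OF RECORD, REDUCED (`readOutAt_u3OfRecord₁₃_iff`, `readOutAt_u3OfRecord₁₃_of`): the window clause is `rfl`+`T4BetaReadOut.extd_mem_window`
  (`u3OfRecord₁₃_W ∕ _γ`) and the six sign∕order clauses are the letter block's `U3Letters₁₁.Signs` — what remains is exactly the FOUR READ-OUT BINDERS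
  `RepresentsA (u.EA k) rA θ.γ D.βfun ∧ RepresentsB (u.EB k) rB θ.γ D.βfun ∧ (slice memberships on `Window θ.γ`) ∧ ReadBoundedOn 𝒜A rA u.κ u.cr ∧ ReadCovariantOn 𝒜A 𝒜B rA rB u.κ u.cr`;
  at the CoPH datum the β read out IS `betaOfRecord₁₃ F N θ.toStage13Params` (`readOutAt_datumOfRecord₁₃CoPH_iff`); (D4) reads the datum ONLY through `βfun` (`readOutAt_congr_βfun`);
  the `S_D4 (RRec₁₃CoPH 𝔯)` face (`s_D4_rRec₁₃CoPH_iff_readOut`).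
* §2 THE ZERO-FUNCTIONAL TEST (`βfun_boxConst_of_readOutAt_zero`): at ZERO run-A∕run-B functionals on ANY carriers with `0 < u.γ`, `ReadOutAt D u` FORCES THE DATUM's β TO BE
  BOX-CONSTANT — one number for every run length on `]0,u.γ]^{k+1}` (`RepresentsA∕B` make each `β k` constant on its box, `ReadCovariantOn` at `M = 0` identifies run A's and run
  B's constants, induction on `k`); conversely at a box-constant β the zero functionals with `cr = 0` DO carry (D4) (`readOutAt_zero_of_boxConst`) — so (D4) excludes
  evidence #5's zero-functional inhabitant EXACTLY at data whose β is not box-stationary (`not_readOutAt_zero_of_not_boxConst`; at the CoPH record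
  `betaOfRecord₁₃_boxConst_of_readOutAt_zero`).  Whether `betaOfRecord₁₃` is box-stationary is NOT decidable here (a `limUnder` object; NODE O's (AF-0) road says no).
* §3 THE β-ENCODING BOUND — WHAT THE (D4)-KEYED U3 SLOTS OF A RESIDUAL READING BOOK (`exists_u3Objects₁₁_readOut_n18_n22_iff_exists_u2Inputs`): for every datum `D` and
  Stage-13 tuple `θ`, «SOME signed U3 objects `u : U3Objects₁₁` carry `ReadOutAt D (u3OfRecord₁₃ θ u k) ∧ N18At (…) ∧ N22At (…)` at every run length» ⟺ «node U2's input
  triple `Spine.NE4.U2Inputs D c C ρ θ.γ Λ` holds for SOME letters `0 ≤ c`, `0 < ρ < 1`».  (⇒) is `Spine.NE4.Targets.u2Inputs_of_u3` BY NAME (dag-n17-a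
  `YMDAG.N17.u2Inputs_of_readOutAt`); (⇐) is THE β-CARRIER SHADOW: level carriers `T4BetaReadOut.betaCarriers`, run A's functional `betaEA D.βfun`, run B's family
  `betaEB D.βfun`, recipe `betaRead` (`representsA∕B_beta`, `readBounded∕readCovariant_beta`, `ne5_beta_of_scaleShiftRate`, `ne9_beta_of_histLipschitz`, `fadingMemory_beta`
  — pub-balaban's `u2Shapes_iff_u3Shapes_on_betaCarrier` placed AT THE BUNDLE-OF-RECORD SHAPE).  READING FOR THE PLAN ((q3) ∕ R3): (D4) lifts v1's residual from N17's
  scale-shift sentence to node U2's FULL TRIPLE on `betaOfRecord₁₃` (N17 ∧ `HistLipschitz` ∧ `FadingMemory`) and kills the ZERO functionals at a non-stationary β, but it does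
  NOT reach node U3's content (NE5 ∕ NE9 for Bałaban's (0.24) term functionals): the `∃ 𝔯` of v2 `stub_rates13H` stays inhabitable by β-ENCODING objects iff `U2Inputs` holds for
  `betaOfRecord₁₃` on `]0,θ.γ]` (`exists_u3Objects₁₁_readOut_n18_n22_datumOfRecord₁₃CoPH_iff`).  R2's BY-NAME pin of `𝔯.lit` (node00-def-W1's reading of U3's functionals) is
  NOT replaceable by (D4).
* §4 THE `∃ 𝔯` OF v2's STUB 1, node-U3 SIDE (`exists_rateReading₁₃CoPH_u3Slots_iff`, guard-generic): a Stage-13 rate reading whose bundles of record carry signed letters and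
  `ReadOutAt ∧ N18At ∧ N22At` at every guarded tuple, every `(g₀, os, k)` EXISTS ⟺ node U2's triple holds for `betaOfRecord₁₃` at every guarded tuple — the `∃ 𝔯`
  quantifier is FREE on the U3 side (tuple-wise choice of §3's β-encoding objects; the other layers filled by `Node00.nonempty_rateObjects₁₁` and the empty dressed tower,
  so N14 ∕ N15 ∕ N16's slots are NOT spoken about — dag-n18-e's evidence #5 covers them).

HONEST FRAMING.  Kernel bookkeeping over the tree's typed SHAPES; nothing of Bałaban's is asserted; (D4) ∕ NE4 ∕ NE5 ∕ NE9 are NOT PRINTED beyond the linearity of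
[Balaban1987RG1] (1.20)–(1.22) p. 264 and NOT proved; no inhabitant of any key is claimed (K0⁷ OPEN); N17 = composite (max of N15, N16, (D4)), NOT discharged; K3⁷ OPEN,
NEITHER claimed NOR refuted (v2 is a draft; v1's stubs untouched); counts UNMOVED (typed 28∕28 · discharged 5∕27, A 5∕28).  One finite four-torus programme at fixed ε per
run — the Yang–Mills mass gap (Clay) is NOT proved by any of this; R4 closes the conditional finite-𝕋⁴ rung `BalabanLadder.UV` only; nothing continuum ∕ ℝ⁴ ∕ OS.
-/

noncomputable section

namespace Summit.QuantumFields.YangMills.BalabanUVNodes.N17D4ReadOutAtRecord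

open Literature.MathematicalPhysics.QuantumFieldTheory.Balaban1983to89
open Literature.MathematicalPhysics.QuantumFieldTheory.Balaban1983to89.FlowStep (Box mem_box HBeta)
open Literature.MathematicalPhysics.QuantumFieldTheory.Balaban1983to89.T4CouplingMatching (ScaleShiftRate HistLipschitz)
open Literature.MathematicalPhysics.QuantumFieldTheory.Balaban1983to89.T4Continuum (T4Family ULoop)
open Literature.MathematicalPhysics.QuantumFieldTheory.Balaban1983to89.T4OutputRate (Carriers Functional Window NE5 NE9 mem_window)
open Literature.MathematicalPhysics.QuantumFieldTheory.Balaban1983to89.T4BetaReadOut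
  (Slice ReadOut SliceClose RepresentsA RepresentsB ReadBounded ReadCovariant extd_mem_window betaCarriers betaEA betaEB betaRead shiftModuli
    representsA_beta representsB_beta readBounded_beta readCovariant_beta ne5_beta_of_scaleShiftRate ne9_beta_of_histLipschitz fadingMemory_beta)
open Literature.MathematicalPhysics.QuantumFieldTheory.Balaban1983to89.T4BetaReadOutLipschitz
  (ReadBoundedOn ReadCovariantOn readBoundedOn_of_readBounded readCovariantOn_of_readCovariant)
open Literature.MathematicalPhysics.QuantumFieldTheory.Balaban1983to89.T4FlagMemory (extd)
open Literature.MathematicalPhysics.QuantumFieldTheory.Balaban1983to89.Node00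
  (Stage13Params Stage13HParams datumOfRecord₁₃CoPH IsDatumOfRecord₁₃CCoPH betaOfRecord₁₃ βfun_datumOfRecord₁₃CoPH U3Objects₁₁ U3Letters₁₁ RateObjects₁₁)
open Summit.QuantumFields.BalabanUV.T4Continuum.Spine.NE4 (U2Inputs)
open YMDAG.UVSplit

variable {N : ℕ} [NeZero N] {F : T4Family}

/-! ## §1 (D4) AT NODE U3's BUNDLE OF RECORD `u3OfRecord₁₃ θ u k`, REDUCED: window and sign clauses discharged by the record -/

section AtBundle

variable (D : Datum F N) (θ : Stage13Params F N) (u : U3Objects₁₁) (k : ℕ)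

/-- **THE WINDOW CLAUSE OF (D4) HOLDS AT THE BUNDLE BY CONSTRUCTION**: the bundle's window IS `]0, θ.γ]^ℕ` and its radius IS `θ.γ` (`u3OfRecord₁₃_W ∕ _γ`, `rfl`), and a
box history padded by its last entry lies in the window (`T4BetaReadOut.extd_mem_window`). [cite: Balaban1987RG1, Thm 1 p.259] -/
theorem box_extd_mem_window_u3OfRecord₁₃ :
    ∀ k' (v : Fin (k' + 1) → ℝ), v ∈ Box (u3OfRecord₁₃ θ u k).γ k' → extd v ∈ (u3OfRecord₁₃ θ u k).W :=
  fun _ _ hv => extd_mem_window hv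

/-- **THE SIX SIGN ∕ ORDER CLAUSES OF (D4) ARE THE LETTER BLOCK's `Signs`** (`0 ≤ cr`, `0 ≤ C₅`, `0 ≤ θ₅`, `0 ≤ ω`, `θ₅ ≤ ρ`, `ω ≤ ρ` at the bundle — its letters ARE
`u`'s, `rfl`). [cite: Balaban1987RG1, (1.20)-(1.22) p.264] -/
theorem signs_u3OfRecord₁₃ (hs : u.Signs) :
    0 ≤ (u3OfRecord₁₃ θ u k).cr ∧ 0 ≤ (u3OfRecord₁₃ θ u k).C₅ ∧ 0 ≤ (u3OfRecord₁₃ θ u k).θ ∧ 0 ≤ (u3OfRecord₁₃ θ u k).ω ∧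
      (u3OfRecord₁₃ θ u k).θ ≤ (u3OfRecord₁₃ θ u k).ρ ∧ (u3OfRecord₁₃ θ u k).ω ≤ (u3OfRecord₁₃ θ u k).ρ :=
  ⟨hs.cr_nonneg, hs.C₅_nonneg, hs.θ₅_pos.le, hs.ω_nonneg, hs.θ₅_le_ρ, hs.ω_le_ρ⟩

/-- **(D4) AT THE BUNDLE OF RECORD, REDUCED (kernel `iff`)**: under the letter signs, `ReadOutAt D (u3OfRecord₁₃ θ u k)` IS exactly the FOUR READ-OUT BINDERS at
run length `k` — SOME slice classes `𝒜A ∕ 𝒜B` and read-out recipes `rA ∕ rB` on the level-`k` pair carriers such that the datum's β-functions ARE the read-out of run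
A's functional `u.EA k` on the `θ.γ`-boxes and of run B's first-coupling family `u.EB k` one step later (`RepresentsA ∕ RepresentsB`, STRUCTURE PRINTED (1.20)–(1.22)),
the functionals' slices over the window lie in the classes, and the recipe is `u.cr`-bounded and transport-covariant on them (`ReadBoundedOn ∕ ReadCovariantOn`, NOT
PRINTED).  The window clause (`box_extd_mem_window_u3OfRecord₁₃`) and the sign clauses (`signs_u3OfRecord₁₃`) are DISCHARGED by the record. [cite: Balaban1987RG1, (1.20)-(1.22) p.264] -/
theorem readOutAt_u3OfRecord₁₃_iff (hs : u.Signs) :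
    ReadOutAt D (u3OfRecord₁₃ θ u k) ↔
      ∃ (𝒜A : Set (Slice (u.levelCarriers k) (u.levelCarriers k).BgA)) (𝒜B : Set (Slice (u.levelCarriers k) (u.levelCarriers k).BgB))
        (rA : ReadOut (u.levelCarriers k) (u.levelCarriers k).BgA) (rB : ReadOut (u.levelCarriers k) (u.levelCarriers k).BgB),
        RepresentsA (u.EA k) rA θ.γ D.βfun ∧ RepresentsB (u.EB k) rB θ.γ D.βfun ∧
        (∀ g ∈ Window θ.γ, u.EA k g ∈ 𝒜A) ∧ (∀ b, 0 < b → b ≤ θ.γ → ∀ g ∈ Window θ.γ, u.EB k b g ∈ 𝒜B) ∧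
        ReadBoundedOn 𝒜A rA u.κ u.cr ∧ ReadCovariantOn 𝒜A 𝒜B rA rB u.κ u.cr := by
  constructor
  · rintro ⟨𝒜A, 𝒜B, rA, rB, -, hA, hB, h𝒜A, h𝒜B, hr, hcov, -⟩
    exact ⟨𝒜A, 𝒜B, rA, rB, hA, hB, h𝒜A, h𝒜B, hr, hcov⟩
  · rintro ⟨𝒜A, 𝒜B, rA, rB, hA, hB, h𝒜A, h𝒜B, hr, hcov⟩
    exact ⟨𝒜A, 𝒜B, rA, rB, box_extd_mem_window_u3OfRecord₁₃ θ u k, hA, hB, h𝒜A, h𝒜B, hr, hcov, signs_u3OfRecord₁₃ θ u k hs⟩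

/-- **THE CONSTRUCTOR**: the four read-out binders at run length `k` under the letter signs GIVE (D4) at the bundle of record. [cite: Balaban1987RG1, (1.20)-(1.22) p.264] -/
theorem readOutAt_u3OfRecord₁₃_of (hs : u.Signs)
    {𝒜A : Set (Slice (u.levelCarriers k) (u.levelCarriers k).BgA)} {𝒜B : Set (Slice (u.levelCarriers k) (u.levelCarriers k).BgB)}
    {rA : ReadOut (u.levelCarriers k) (u.levelCarriers k).BgA} {rB : ReadOut (u.levelCarriers k) (u.levelCarriers k).BgB}
    (hA : RepresentsA (u.EA k) rA θ.γ D.βfun) (hB : RepresentsB (u.EB k) rB θ.γ D.βfun)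
    (h𝒜A : ∀ g ∈ Window θ.γ, u.EA k g ∈ 𝒜A) (h𝒜B : ∀ b, 0 < b → b ≤ θ.γ → ∀ g ∈ Window θ.γ, u.EB k b g ∈ 𝒜B)
    (hr : ReadBoundedOn 𝒜A rA u.κ u.cr) (hcov : ReadCovariantOn 𝒜A 𝒜B rA rB u.κ u.cr) :
    ReadOutAt D (u3OfRecord₁₃ θ u k) :=
  (readOutAt_u3OfRecord₁₃_iff D θ u k hs).mpr ⟨𝒜A, 𝒜B, rA, rB, hA, hB, h𝒜A, h𝒜B, hr, hcov⟩

/-- **WITH THE UNRESTRICTED BINDERS** (`T4BetaReadOut.ReadBounded ∕ ReadCovariant`, classes `univ`): the two representations and the unrestricted read-out bound and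
pairing convention give (D4) at the bundle (`readBoundedOn_of_readBounded`, `readCovariantOn_of_readCovariant`). [cite: Balaban1987RG1, (1.20)-(1.22) p.264] -/
theorem readOutAt_u3OfRecord₁₃_of_univ (hs : u.Signs)
    {rA : ReadOut (u.levelCarriers k) (u.levelCarriers k).BgA} {rB : ReadOut (u.levelCarriers k) (u.levelCarriers k).BgB}
    (hA : RepresentsA (u.EA k) rA θ.γ D.βfun) (hB : RepresentsB (u.EB k) rB θ.γ D.βfun)
    (hr : ReadBounded rA u.κ u.cr) (hcov : ReadCovariant rA rB u.κ u.cr) :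
    ReadOutAt D (u3OfRecord₁₃ θ u k) :=
  readOutAt_u3OfRecord₁₃_of D θ u k hs (𝒜A := Set.univ) (𝒜B := Set.univ) hA hB (fun _ _ => Set.mem_univ _)
    (fun _ _ _ _ _ => Set.mem_univ _) (readBoundedOn_of_readBounded _ hr) (readCovariantOn_of_readCovariant _ _ hcov)

end AtBundle

/-- **(D4) READS THE DATUM ONLY THROUGH ITS β-FAMILY**: two data (of any two families) with the same `βfun` carry `ReadOutAt · u` together — the transfer shape along
NODE 00's stage refinements (the ₉∕₁₁∕₁₂ companions' `readOutAt_datumOfRecord*_iff_stage*` pattern, datum-generic). [folklore] -/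
theorem readOutAt_congr_βfun {F F' : T4Family} {D : Datum F N} {D' : Datum F' N} (h : D.βfun = D'.βfun) (u : U3Carriers) :
    ReadOutAt D u ↔ ReadOutAt D' u := by
  unfold ReadOutAt
  rw [h]

/-- **(D4) AT THE STAGE-13 CoPH DATUM OF RECORD READS `betaOfRecord₁₃`**: at `datumOfRecord₁₃CoPH F N θ hP` and the bundle `u3OfRecord₁₃ θ.toStage13Params u k`, under the
signs, (D4) IS the four read-out binders with the β-FUNCTIONS OF RECORD `betaOfRecord₁₃ F N θ.toStage13Params` ([I] (1.20)–(1.22) on the merged term, box convention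
to the one-loop number) as the represented family (`Node00.βfun_datumOfRecord₁₃CoPH`, `rfl`). [cite: Balaban1987RG1, (1.20)-(1.22) p.264] -/
theorem readOutAt_datumOfRecord₁₃CoPH_iff (θ : Stage13HParams F N) (hP : θ.Provisos₁₃CoPH F N) (u : U3Objects₁₁) (k : ℕ) (hs : u.Signs) :
    ReadOutAt (datumOfRecord₁₃CoPH F N θ hP) (u3OfRecord₁₃ θ.toStage13Params u k) ↔
      ∃ (𝒜A : Set (Slice (u.levelCarriers k) (u.levelCarriers k).BgA)) (𝒜B : Set (Slice (u.levelCarriers k) (u.levelCarriers k).BgB))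
        (rA : ReadOut (u.levelCarriers k) (u.levelCarriers k).BgA) (rB : ReadOut (u.levelCarriers k) (u.levelCarriers k).BgB),
        RepresentsA (u.EA k) rA θ.γ (betaOfRecord₁₃ F N θ.toStage13Params) ∧ RepresentsB (u.EB k) rB θ.γ (betaOfRecord₁₃ F N θ.toStage13Params) ∧
        (∀ g ∈ Window θ.γ, u.EA k g ∈ 𝒜A) ∧ (∀ b, 0 < b → b ≤ θ.γ → ∀ g ∈ Window θ.γ, u.EB k b g ∈ 𝒜B) ∧
        ReadBoundedOn 𝒜A rA u.κ u.cr ∧ ReadCovariantOn 𝒜A 𝒜B rA rB u.κ u.cr := by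
  rw [readOutAt_u3OfRecord₁₃_iff _ _ u k hs, βfun_datumOfRecord₁₃CoPH]

/-- **THE `S_D4` FACE AT THE STAGE-13 CoPH HOME, REDUCED**: for a Stage-13 rate reading `𝔯` whose node-U3 letter blocks are SIGNED at every admissible tuple with provisos,
`S_D4 (RRec₁₃CoPH 𝔯)` ⟺ at every Stage-13 datum key and every run length `k`, the four read-out binders for the reading's level-`k` functionals with `D.βfun` represented
(layer B's `s_D4_rRec₁₃CoPH_iff` ∘ §1). [cite: Balaban1987RG1, (1.20)-(1.22) p.264] -/
theorem s_D4_rRec₁₃CoPH_iff_readOut (𝔯 : RateReading₁₃CoPH N)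
    (hs : ∀ (F : T4Family) (θ : Stage13HParams F N) (hP : θ.Provisos₁₃CoPH F N), θ.Admissible F N →
      ∀ (g₀ : ℕ → ℝ) (os : List (ULoop F)), ((𝔯.lit F θ hP g₀ os).u3).Signs) :
    S_D4 (RRec₁₃CoPH 𝔯) ↔
      ∀ (F : T4Family) (D : Datum F N) (h : IsDatumOfRecord₁₃CCoPH F N D) (g₀ : ℕ → ℝ) (os : List (ULoop F)) (k : ℕ),
        ∃ (𝒜A : Set (Slice (((𝔯.lit F h.params h.provisos g₀ os).u3).levelCarriers k) (((𝔯.lit F h.params h.provisos g₀ os).u3).levelCarriers k).BgA))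
          (𝒜B : Set (Slice (((𝔯.lit F h.params h.provisos g₀ os).u3).levelCarriers k) (((𝔯.lit F h.params h.provisos g₀ os).u3).levelCarriers k).BgB))
          (rA : ReadOut (((𝔯.lit F h.params h.provisos g₀ os).u3).levelCarriers k) (((𝔯.lit F h.params h.provisos g₀ os).u3).levelCarriers k).BgA)
          (rB : ReadOut (((𝔯.lit F h.params h.provisos g₀ os).u3).levelCarriers k) (((𝔯.lit F h.params h.provisos g₀ os).u3).levelCarriers k).BgB),
          RepresentsA (((𝔯.lit F h.params h.provisos g₀ os).u3).EA k) rA h.params.γ D.βfun ∧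
          RepresentsB (((𝔯.lit F h.params h.provisos g₀ os).u3).EB k) rB h.params.γ D.βfun ∧
          (∀ g ∈ Window h.params.γ, ((𝔯.lit F h.params h.provisos g₀ os).u3).EA k g ∈ 𝒜A) ∧
          (∀ b, 0 < b → b ≤ h.params.γ → ∀ g ∈ Window h.params.γ, ((𝔯.lit F h.params h.provisos g₀ os).u3).EB k b g ∈ 𝒜B) ∧
          ReadBoundedOn 𝒜A rA ((𝔯.lit F h.params h.provisos g₀ os).u3).κ ((𝔯.lit F h.params h.provisos g₀ os).u3).cr ∧
          ReadCovariantOn 𝒜A 𝒜B rA rB ((𝔯.lit F h.params h.provisos g₀ os).u3).κ ((𝔯.lit F h.params h.provisos g₀ os).u3).cr := by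
  rw [s_D4_rRec₁₃CoPH_iff]
  refine forall₅_congr fun F D h g₀ os => forall_congr' fun k => ?_
  exact readOutAt_u3OfRecord₁₃_iff D h.params.toStage13Params _ k (hs F h.params h.provisos h.admissible g₀ os)

/-! ## §2 THE ZERO-FUNCTIONAL TEST: at zero run-A ∕ run-B functionals (D4) forces a BOX-CONSTANT β (dag-n18-e evidence #5's `junkU3` shape) -/

section ZeroFunctionals

variable (D : Datum F N) {u : U3Carriers}

/-- **AT ZERO FUNCTIONALS, (D4) FORCES THE DATUM's β TO BE BOX-CONSTANT (kernel).**  If run A's functional and run B's first-coupling family VANISH IDENTICALLY (dag-n18-e's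
`junkU3`: «NODE U3's carriers with ZERO functionals», on ANY carriers) and the window radius is positive, then `ReadOutAt D u` implies that EVERY β-function of the datum takes
ONE AND THE SAME VALUE on its box: `D.βfun k v = D.βfun 0 (γ, …)` for all `k` and all `v ∈ ]0,u.γ]^{k+1}`.  Proof: `RepresentsA` makes `β k` constant `= rA k 0` on the box,
`RepresentsB` makes `β (k+1)` constant `= rB k 0`, the pairing convention `ReadCovariantOn` at closeness `M = 0` (the two zero slices are 0-close through any transport) gives
`rA k 0 = rB k 0`, and induction on `k` chains the constants.  So (D4) EXCLUDES the zero-functional inhabitant at every datum whose β-family is not box-stationary.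
[cite: Balaban1987RG1, (1.20)-(1.22) p.264] -/
theorem βfun_boxConst_of_readOutAt_zero (hγ : 0 < u.γ) (hA0 : ∀ g U X, u.EA g U X = 0) (hB0 : ∀ b g U X, u.EB b g U X = 0)
    (h : ReadOutAt D u) : ∀ k (v : Fin (k + 1) → ℝ), v ∈ Box u.γ k → D.βfun k v = D.βfun 0 fun _ => u.γ := by
  obtain ⟨𝒜A, 𝒜B, rA, rB, hW, hA, hB, h𝒜A, h𝒜B, -, hcov, -⟩ := h
  set ZA : Slice u.C u.C.BgA := fun _ _ => 0 with hZA
  set ZB : Slice u.C u.C.BgB := fun _ _ => 0 with hZB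
  have hEA : ∀ g, u.EA g = ZA := fun g => funext fun U => funext fun X => hA0 g U X
  have hEB : ∀ b g, u.EB b g = ZB := fun b g => funext fun U => funext fun X => hB0 b g U X
  have hcγ : ∀ k, (fun _ : Fin (k + 1) => u.γ) ∈ Box u.γ k := fun k => mem_box.mpr fun _ => ⟨hγ, le_rfl⟩
  have hgW : extd (fun _ : Fin 1 => u.γ) ∈ u.W := hW 0 _ (hcγ 0)
  have hZA𝒜 : ZA ∈ 𝒜A := by rw [← hEA]; exact h𝒜A _ hgW
  have hZB𝒜 : ZB ∈ 𝒜B := by rw [← hEB u.γ]; exact h𝒜B u.γ hγ le_rfl _ hgW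
  have hβA : ∀ k (v : Fin (k + 1) → ℝ), v ∈ Box u.γ k → D.βfun k v = rA k ZA := fun k v hv => by rw [hA k v hv, hEA]
  have hβB : ∀ k (w : Fin (k + 2) → ℝ), w ∈ Box u.γ (k + 1) → D.βfun (k + 1) w = rB k ZB := fun k w hw => by rw [hB k w hw, hEB]
  have hAB : ∀ k, rA k ZA = rB k ZB := fun k => by
    have h0 : ∀ (U : u.C.BgB) (X : u.C.Dom), u.C.scale X = k + 1 → |ZA (u.C.transport U) X - ZB U X| ≤ 0 * Real.exp (-(u.κ * u.C.d X)) :=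
      fun U X _ => by simp [hZA, hZB]
    have := hcov k ZA ZB 0 hZA𝒜 hZB𝒜 h0
    rw [mul_zero] at this
    exact eq_of_abs_sub_nonpos this
  have hstep : ∀ k, rA (k + 1) ZA = rA k ZA := fun k => by rw [← hβA (k + 1) _ (hcγ (k + 1)), hβB k _ (hcγ (k + 1)), hAB]
  have hall : ∀ k, rA k ZA = rA 0 ZA := fun k => by
    induction k with
    | zero => rfl
    | succ k ih => rw [hstep, ih]
  intro k v hv
  rw [hβA k v hv, hall, ← hβA 0 _ (hcγ 0)]

/-- **CONTRAPOSITIVE — (D4) EXCLUDES THE ZERO FUNCTIONALS AT A NON-STATIONARY β**: if some β-function of the datum takes, somewhere on its `u.γ`-box, a value other than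
`D.βfun 0 (γ)`, then NO zero-functional U3 carriers with radius `u.γ > 0` carry `ReadOutAt D u` — whatever their domains, scales, backgrounds, transport, letters.
[cite: Balaban1987RG1, (1.20)-(1.22) p.264] -/
theorem not_readOutAt_zero_of_not_boxConst (hγ : 0 < u.γ) (hA0 : ∀ g U X, u.EA g U X = 0) (hB0 : ∀ b g U X, u.EB b g U X = 0)
    (hnc : ∃ (k : ℕ) (v : Fin (k + 1) → ℝ), v ∈ Box u.γ k ∧ D.βfun k v ≠ D.βfun 0 fun _ => u.γ) : ¬ ReadOutAt D u := by
  rintro h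
  obtain ⟨k, v, hv, hne⟩ := hnc
  exact hne (βfun_boxConst_of_readOutAt_zero D hγ hA0 hB0 h k v hv)

/-- **CONVERSELY, AT A BOX-CONSTANT β THE ZERO FUNCTIONALS WITH `cr = 0` DO CARRY (D4)** (so §2's exclusion is sharp: the degenerate corner is β box-stationary): constant
recipes `rA k F := a`, `rB k G := a` on the one-element classes `{0}` represent a β that is `a` on every box, and are `0`-bounded ∕ `0`-covariant.  The remaining (D4) clauses
are the displayed window and sign hypotheses. [cite: Balaban1987RG1, (1.20)-(1.22) p.264] -/
theorem readOutAt_zero_of_boxConst (hA0 : ∀ g U X, u.EA g U X = 0) (hB0 : ∀ b g U X, u.EB b g U X = 0)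
    (hW : ∀ k (v : Fin (k + 1) → ℝ), v ∈ Box u.γ k → extd v ∈ u.W) (hcr : u.cr = 0)
    (hC₅ : 0 ≤ u.C₅) (hθ : 0 ≤ u.θ) (hω : 0 ≤ u.ω) (hθρ : u.θ ≤ u.ρ) (hωρ : u.ω ≤ u.ρ)
    {a : ℝ} (hβ : ∀ k (v : Fin (k + 1) → ℝ), v ∈ Box u.γ k → D.βfun k v = a) : ReadOutAt D u := by
  have hEA : ∀ g, u.EA g = fun _ _ => 0 := fun g => funext fun U => funext fun X => hA0 g U X
  have hEB : ∀ b g, u.EB b g = fun _ _ => 0 := fun b g => funext fun U => funext fun X => hB0 b g U X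
  refine ⟨{fun _ _ => 0}, {fun _ _ => 0}, fun _ _ => a, fun _ _ => a, hW, ?_, ?_, ?_, ?_, ?_, ?_, le_of_eq hcr.symm, hC₅, hθ, hω, hθρ, hωρ⟩
  · intro k v hv
    exact hβ k v hv
  · intro k w hw
    exact hβ (k + 1) w hw
  · intro g _
    rw [hEA]; exact Set.mem_singleton _
  · intro b _ _ g _
    rw [hEB]; exact Set.mem_singleton _
  · intro k F G M _ _ _
    simp [hcr]
  · intro k F G M _ _ _
    simp [hcr]

end ZeroFunctionals

/-- **THE ZERO-FUNCTIONAL TEST AT THE STAGE-13 CoPH RECORD** (plan (q3) ∕ R3 for dag-n18-e's `keyedRates_junk`): if a Stage-13 reading's node-U3 objects have ZERO level-`k`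
functionals, then (D4) at the bundle of record on the datum of record FORCES `betaOfRecord₁₃ F N θ.toStage13Params` to be BOX-CONSTANT on `]0, θ.γ]` — one number for every
run length (`0 < θ.γ` displayed).  NODE O's (AF-0) road denies box-stationarity of the β of record; that denial is NOT this file's (a `limUnder` object).
[cite: Balaban1987RG1, (1.20)-(1.22) p.264, (2.9) p.266] -/
theorem betaOfRecord₁₃_boxConst_of_readOutAt_zero (θ : Stage13HParams F N) (hP : θ.Provisos₁₃CoPH F N) (u : U3Objects₁₁) (k : ℕ) (hγ : 0 < θ.γ)
    (hA0 : ∀ g U X, u.EA k g U X = 0) (hB0 : ∀ b g U X, u.EB k b g U X = 0)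
    (h : ReadOutAt (datumOfRecord₁₃CoPH F N θ hP) (u3OfRecord₁₃ θ.toStage13Params u k)) :
    ∀ k' (v : Fin (k' + 1) → ℝ), v ∈ Box θ.γ k' →
      betaOfRecord₁₃ F N θ.toStage13Params k' v = betaOfRecord₁₃ F N θ.toStage13Params 0 fun _ => θ.γ :=
  βfun_boxConst_of_readOutAt_zero (datumOfRecord₁₃CoPH F N θ hP) (u := u3OfRecord₁₃ θ.toStage13Params u k) hγ hA0 hB0 h

/-! ## §3 THE β-ENCODING BOUND: the (D4)-keyed U3 slots of a RESIDUAL reading book EXACTLY node U2's input triple on the datum's β -/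

section BetaEncoding

variable (D : Datum F N) (θ : Stage13Params F N)

/-- **(⇒) THE (D4)-KEYED U3 SLOTS AT THE BUNDLE GIVE node U2's WHOLE INPUT TRIPLE ON THE DATUM** (dag-n17-a `YMDAG.N17.u2Inputs_of_readOutAt` = `Spine.NE4.Targets.u2Inputs_of_u3`
BY NAME, at the bundle's letters): `ReadOutAt ∧ N18At ∧ N22At` at `u3OfRecord₁₃ θ u k` ⟹ `U2Inputs D (cr·C₅·θ₅) (cr·C₉·ω) ρ θ.γ (a i ↦ cr·moduli (a+1) i)` — N17's
sentence ∧ `HistLipschitz` ∧ `FadingMemory` for `D.βfun` on `]0,θ.γ]`.  Every input UNPRINTED. [cite: Balaban1987RG1, §5 p.298] -/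
theorem u2Inputs_of_readOut_n18_n22_u3OfRecord₁₃ (u : U3Objects₁₁) (k : ℕ) (hD4 : ReadOutAt D (u3OfRecord₁₃ θ u k))
    (h18 : N18At (u3OfRecord₁₃ θ u k)) (h22 : N22At (u3OfRecord₁₃ θ u k)) :
    U2Inputs D (u.cr * u.C₅ * u.θ₅) (u.cr * u.C₉ * u.ω) u.ρ θ.γ (fun a i => u.cr * u.moduli (a + 1) i) :=
  YMDAG.N17.u2Inputs_of_readOutAt D hD4 h18 h22

/-- **(⇐) THE β-CARRIER SHADOW AT THE BUNDLE-OF-RECORD SHAPE (kernel)**: if node U2's input triple `U2Inputs D c C ρ θ.γ Λ` holds for the datum's β with `0 ≤ c`, `0 < ρ < 1`,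
then the β-ENCODING U3 objects — level carriers `T4BetaReadOut.betaCarriers` (domains `ℕ`, scale `n+1`, one-point backgrounds, identity transport) at every run length,
run A's functional `betaEA D.βfun` (the β-family itself), run B's family `betaEB D.βfun` (the datum consed in front), letter block `κ := 0, θ₅ := ρ, C₅ := c∕ρ, C₉ := C∕ρ,
ω := ρ, cr := 1, ρ := ρ` — are SIGNED and carry `ReadOutAt D (u3OfRecord₁₃ θ u k) ∧ N18At (…) ∧ N22At (…)` AT EVERY RUN LENGTH: (D4) by evaluation (`representsA∕B_beta`,
`readBounded∕readCovariant_beta`, §1's constructor), N18 = NE5 by `ne5_beta_of_scaleShiftRate`, N22 = NE9 by `ne9_beta_of_histLipschitz` with the transported moduli dominated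
by the letter block's `C₉·ω^{a−i}` (`fadingMemory_beta`, dag-n22's `YMDAG.N22.ne9_of_moduli_le`) and fading memory by the letter signs (`fadingMemory_u3OfRecord₁₃`).  So (D4) does NOT pin run A's
functional to Bałaban's (0.24) terms: the datum's own β-functions inhabit the keyed U3 slots. [cite: Balaban1987RG1, (1.20)-(1.22) p.264] -/
theorem exists_u3Objects₁₁_readOut_n18_n22_of_u2Inputs {c C ρ : ℝ} {Λ : ℕ → ℕ → ℝ} (hc : 0 ≤ c) (hρ0 : 0 < ρ) (hρ1 : ρ < 1)
    (h : U2Inputs D c C ρ θ.γ Λ) :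
    ∃ u : U3Objects₁₁, u.Signs ∧ ∀ k, ReadOutAt D (u3OfRecord₁₃ θ u k) ∧ N18At (u3OfRecord₁₃ θ u k) ∧ N22At (u3OfRecord₁₃ θ u k) := by
  obtain ⟨hS, hL, hM⟩ := h
  -- node U2's `FadingMemory` is node U3's verbatim (`T4OutputRate.FadingMemory`, definitionally), so its constant is nonnegative by name
  have hC : 0 ≤ C := T4BetaReadOut.fadingMemory_const_nonneg (show T4OutputRate.FadingMemory C ρ Λ from hM)
  let u : U3Objects₁₁ :=
    { κ := 0, θ₅ := ρ, C₅ := c / ρ, C₉ := C / ρ, ω := ρ, cr := 1, ρ := ρ,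
      levelCarriers := fun _ => betaCarriers, EA := fun _ => betaEA D.βfun, EB := fun _ => betaEB D.βfun }
  have hs : u.Signs :=
    { κ_nonneg := le_rfl, θ₅_pos := hρ0, θ₅_lt_one := hρ1, C₅_nonneg := div_nonneg hc hρ0.le, C₉_nonneg := div_nonneg hC hρ0.le,
      ω_nonneg := hρ0.le, ω_lt_one := hρ1, cr_nonneg := zero_le_one, θ₅_le_ρ := le_rfl, ω_le_ρ := le_rfl, ρ_lt_one := hρ1 }
  refine ⟨u, hs, fun k => ⟨?_, ?_, ?_⟩⟩
  · exact readOutAt_u3OfRecord₁₃_of_univ D θ u k hs (representsA_beta D.βfun θ.γ) (representsB_beta D.βfun θ.γ) readBounded_beta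
      readCovariant_beta
  · intro b hb0 hbγ
    exact ne5_beta_of_scaleShiftRate hρ0 hS hb0 hbγ
  · refine ⟨?_, fadingMemory_u3OfRecord₁₃ θ u k hs⟩
    have hmod := fadingMemory_beta hρ0 hM
    exact YMDAG.N22.ne9_of_moduli_le (fun n i hi => (hmod n i hi.le).2) (ne9_beta_of_histLipschitz hL)

/-- **THE β-ENCODING BOUND, BOTH DIRECTIONS — WHAT THE (D4)-KEYED U3 SLOTS OF A RESIDUAL READING BOOK (kernel `iff`; plan (q3) in substance).**  For every datum `D` and
Stage-13 tuple `θ`: SOME signed node-U3 objects carry `ReadOutAt D (u3OfRecord₁₃ θ u k) ∧ N18At (…) ∧ N22At (…)` at every run length ⟺ node U2's input triple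
`Spine.NE4.U2Inputs D c C ρ θ.γ Λ` (= N17's scale-shift sentence ∧ `HistLipschitz Λ` ∧ `FadingMemory C ρ Λ` for `D.βfun` on `]0,θ.γ]`) holds for SOME letters `0 ≤ c`,
`0 < ρ < 1`.  READING: with `𝔯` RESIDUAL the (D4)-keyed U3 side of K3⁷ v2's `PHolderD4` at the bundle of record is worth EXACTLY node U2's triple on the datum — it lifts v1's
residual (N17's sentence alone, dag-n18-e evidence #5) by the history-moduli ∕ fading-memory companions and excludes the ZERO functionals at a non-stationary β (§2), but
node U3's content (NE5 ∕ NE9 for Bałaban's term functionals) enters ONLY through a BY-NAME pin of `𝔯.lit` (plan R2). [cite: Balaban1987RG1, (1.20)-(1.22) p.264 and §5 p.298] -/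
theorem exists_u3Objects₁₁_readOut_n18_n22_iff_exists_u2Inputs :
    (∃ u : U3Objects₁₁, u.Signs ∧ ∀ k, ReadOutAt D (u3OfRecord₁₃ θ u k) ∧ N18At (u3OfRecord₁₃ θ u k) ∧ N22At (u3OfRecord₁₃ θ u k)) ↔
      ∃ (c C ρ : ℝ) (Λ : ℕ → ℕ → ℝ), 0 ≤ c ∧ 0 < ρ ∧ ρ < 1 ∧ U2Inputs D c C ρ θ.γ Λ := by
  constructor
  · rintro ⟨u, hs, h⟩
    obtain ⟨hD4, h18, h22⟩ := h 0
    exact ⟨_, _, _, _, mul_nonneg (mul_nonneg hs.cr_nonneg hs.C₅_nonneg) hs.θ₅_pos.le, hs.θ₅_pos.trans_le hs.θ₅_le_ρ, hs.ρ_lt_one,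
      u2Inputs_of_readOut_n18_n22_u3OfRecord₁₃ D θ u 0 hD4 h18 h22⟩
  · rintro ⟨c, C, ρ, Λ, hc, hρ0, hρ1, h⟩
    exact exists_u3Objects₁₁_readOut_n18_n22_of_u2Inputs D θ hc hρ0 hρ1 h

/-- **ONE RUN LENGTH SUFFICES ON THE LEFT** (the v2 draft reads ONE selected run length `ksel` per tuple): SOME signed U3 objects and SOME run length `k` with
`ReadOutAt ∧ N18At ∧ N22At` at `u3OfRecord₁₃ θ u k` ⟺ the same right-hand side — so a run-length selector adds nothing to the booking. [cite: Balaban1987RG1, (1.20)-(1.22) p.264] -/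
theorem exists_u3Objects₁₁_readOut_n18_n22_at_iff_exists_u2Inputs :
    (∃ (u : U3Objects₁₁) (k : ℕ), u.Signs ∧ ReadOutAt D (u3OfRecord₁₃ θ u k) ∧ N18At (u3OfRecord₁₃ θ u k) ∧ N22At (u3OfRecord₁₃ θ u k)) ↔
      ∃ (c C ρ : ℝ) (Λ : ℕ → ℕ → ℝ), 0 ≤ c ∧ 0 < ρ ∧ ρ < 1 ∧ U2Inputs D c C ρ θ.γ Λ := by
  constructor
  · rintro ⟨u, k, hs, hD4, h18, h22⟩
    exact ⟨_, _, _, _, mul_nonneg (mul_nonneg hs.cr_nonneg hs.C₅_nonneg) hs.θ₅_pos.le, hs.θ₅_pos.trans_le hs.θ₅_le_ρ, hs.ρ_lt_one,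
      u2Inputs_of_readOut_n18_n22_u3OfRecord₁₃ D θ u k hD4 h18 h22⟩
  · rintro ⟨c, C, ρ, Λ, hc, hρ0, hρ1, h⟩
    obtain ⟨u, hs, hall⟩ := exists_u3Objects₁₁_readOut_n18_n22_of_u2Inputs D θ hc hρ0 hρ1 h
    exact ⟨u, 0, hs, hall 0⟩

end BetaEncoding

/-- **THE β-ENCODING BOUND AT THE STAGE-13 CoPH DATUM OF RECORD** (the shape K3⁷ v2's `stub_rates13H` quantifies over, `∃ 𝔯`, node-U3 side): SOME signed U3 objects carry
`ReadOutAt ∧ N18At ∧ N22At` at `(datumOfRecord₁₃CoPH F N θ hP, u3OfRecord₁₃ θ.toStage13Params u k)` for every `k` ⟺ for SOME letters `0 ≤ c`, `0 < ρ < 1`, `C`, `Λ`: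
`ScaleShiftRate c ρ θ.γ β₁₃ ∧ HistLipschitz Λ θ.γ β₁₃ ∧ FadingMemory C ρ Λ` with `β₁₃ := betaOfRecord₁₃ F N θ.toStage13Params` (`Node00.βfun_datumOfRecord₁₃CoPH`).  N17's sentence
for `β₁₃` is the first conjunct — so the v2 key's U3 side, over a residual `𝔯`, is N17-priced plus the two history companions, and no more. [cite: Balaban1987RG1, (1.20)-(1.22) p.264, (2.9) p.266] -/
theorem exists_u3Objects₁₁_readOut_n18_n22_datumOfRecord₁₃CoPH_iff (θ : Stage13HParams F N) (hP : θ.Provisos₁₃CoPH F N) :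
    (∃ u : U3Objects₁₁, u.Signs ∧ ∀ k, ReadOutAt (datumOfRecord₁₃CoPH F N θ hP) (u3OfRecord₁₃ θ.toStage13Params u k) ∧
        N18At (u3OfRecord₁₃ θ.toStage13Params u k) ∧ N22At (u3OfRecord₁₃ θ.toStage13Params u k)) ↔
      ∃ (c C ρ : ℝ) (Λ : ℕ → ℕ → ℝ), 0 ≤ c ∧ 0 < ρ ∧ ρ < 1 ∧
        ScaleShiftRate c ρ θ.γ (betaOfRecord₁₃ F N θ.toStage13Params) ∧ HistLipschitz Λ θ.γ (betaOfRecord₁₃ F N θ.toStage13Params) ∧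
          T4CouplingMatching.FadingMemory C ρ Λ := by
  rw [exists_u3Objects₁₁_readOut_n18_n22_iff_exists_u2Inputs]
  simp only [U2Inputs, βfun_datumOfRecord₁₃CoPH]

/-! ## §4 THE `∃ 𝔯` OF K3⁷ v2's STUB 1, node-U3 SIDE: a Stage-13 rate reading carrying the (D4)-keyed U3 slots at the bundle of record EXISTS iff
node U2's triple holds for `betaOfRecord₁₃` at every guarded tuple -/

/-- **THE `∃ 𝔯` QUANTIFIER IS FREE ON THE U3 SIDE (kernel `iff`, guard-generic).**  For ANY guard `P` on the Stage-13 tuples with provisos (v2's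
`θ.ZhUnity ∧ θ.SlotsNondegenerate₁₃ → θ.Admissible →`, or any other): there EXISTS a Stage-13 rate reading `𝔯 : RateReading₁₃CoPH N` whose bundles of record
`rateCarriersOfRecord₁₃CoPH 𝔯 F θ hP g₀ os k` carry, at every guarded tuple, every `(g₀, os)` and EVERY run length `k`, SIGNED U3 letters together with
`ReadOutAt (datumOfRecord₁₃CoPH F N θ hP) (…).u3 ∧ N18At (…).u3 ∧ N22At (…).u3` ⟺ at every guarded tuple node U2's triple holds for the β OF RECORD:
`ScaleShiftRate c ρ θ.γ β₁₃ ∧ HistLipschitz Λ θ.γ β₁₃ ∧ FadingMemory C ρ Λ` for SOME `0 ≤ c`, `0 < ρ < 1`, `C`, `Λ` (`β₁₃ := betaOfRecord₁₃ F N θ.toStage13Params`).  (⇒) §3 at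
`(g₀, os) := (0, [])`; (⇐) the reading whose node-U3 objects are the β-ENCODING objects of §3 chosen tuple-wise (`Classical.choose`), the other layers filled by the
containers' trivial inhabitants (`Node00.nonempty_rateObjects₁₁`, the empty dressed tower) — which is why this is a statement about the U3 side ONLY (N14 ∕ N15 ∕ N16's
slots at such a reading are dag-n18-e's evidence #5, not repeated here).  READING FOR v2 `stub_rates13H`: its `∃ 𝔯` does not make the U3 conjuncts of `PHolderD4` say
anything about Bałaban's term functionals; they say node U2's triple about `betaOfRecord₁₃`, tuple-wise. [cite: Balaban1987RG1, (1.20)-(1.22) p.264, (2.9) p.266] -/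
theorem exists_rateReading₁₃CoPH_u3Slots_iff (P : (F : T4Family) → (θ : Stage13HParams F N) → θ.Provisos₁₃CoPH F N → Prop) :
    (∃ 𝔯 : RateReading₁₃CoPH N, ∀ (F : T4Family) (θ : Stage13HParams F N) (hP : θ.Provisos₁₃CoPH F N), P F θ hP →
        ∀ (g₀ : ℕ → ℝ) (os : List (ULoop F)) (k : ℕ),
          ((𝔯.lit F θ hP g₀ os).u3).Signs ∧
          ReadOutAt (datumOfRecord₁₃CoPH F N θ hP) (rateCarriersOfRecord₁₃CoPH 𝔯 F θ hP g₀ os k).u3 ∧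
          N18At (rateCarriersOfRecord₁₃CoPH 𝔯 F θ hP g₀ os k).u3 ∧ N22At (rateCarriersOfRecord₁₃CoPH 𝔯 F θ hP g₀ os k).u3) ↔
      ∀ (F : T4Family) (θ : Stage13HParams F N) (hP : θ.Provisos₁₃CoPH F N), P F θ hP →
        ∃ (c C ρ : ℝ) (Λ : ℕ → ℕ → ℝ), 0 ≤ c ∧ 0 < ρ ∧ ρ < 1 ∧
          ScaleShiftRate c ρ θ.γ (betaOfRecord₁₃ F N θ.toStage13Params) ∧ HistLipschitz Λ θ.γ (betaOfRecord₁₃ F N θ.toStage13Params) ∧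
            T4CouplingMatching.FadingMemory C ρ Λ := by
  classical
  constructor
  · rintro ⟨𝔯, h⟩ F θ hP hθ
    refine (exists_u3Objects₁₁_readOut_n18_n22_datumOfRecord₁₃CoPH_iff θ hP).mp ⟨(𝔯.lit F θ hP (fun _ => 0) []).u3, ?_, fun k => ?_⟩
    · exact (h F θ hP hθ (fun _ => 0) [] 0).1
    · exact (h F θ hP hθ (fun _ => 0) [] k).2
  · intro h
    -- tuple-wise β-encoding U3 objects (choice), the other layers trivial
    have hU : ∀ (F : T4Family) (θ : Stage13HParams F N) (hP : θ.Provisos₁₃CoPH F N), P F θ hP →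
        ∃ u : U3Objects₁₁, u.Signs ∧ ∀ k, ReadOutAt (datumOfRecord₁₃CoPH F N θ hP) (u3OfRecord₁₃ θ.toStage13Params u k) ∧
          N18At (u3OfRecord₁₃ θ.toStage13Params u k) ∧ N22At (u3OfRecord₁₃ θ.toStage13Params u k) :=
      fun F θ hP hθ => (exists_u3Objects₁₁_readOut_n18_n22_datumOfRecord₁₃CoPH_iff θ hP).mpr (h F θ hP hθ)
    let o₀ : RateObjects₁₁ N := Classical.choice (Node00.nonempty_rateObjects₁₁ N)
    let lit : (F : T4Family) → (θ : Stage13HParams F N) → θ.Provisos₁₃CoPH F N → (ℕ → ℝ) → List (ULoop F) → RateObjects₁₁ N :=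
      fun F θ hP _ _ => if hθ : P F θ hP then { o₀ with u3 := Classical.choose (hU F θ hP hθ) } else o₀
    let ne1 : (F : T4Family) → (θ : Stage13HParams F N) → θ.Provisos₁₃CoPH F N → (ℕ → ℝ) → List (ULoop F) → NE1pCarriers :=
      fun _ _ _ _ _ => ⟨PEmpty, ⟨fun p => p.elim, fun p => p.elim, fun p => p.elim⟩, 0⟩
    refine ⟨⟨lit, ne1⟩, fun F θ hP hθ g₀ os k => ?_⟩
    have hlit : (lit F θ hP g₀ os).u3 = Classical.choose (hU F θ hP hθ) := by
      simp only [lit, dif_pos hθ]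
    obtain ⟨hs, hall⟩ := Classical.choose_spec (hU F θ hP hθ)
    show (lit F θ hP g₀ os).u3.Signs ∧ ReadOutAt _ (u3OfRecord₁₃ θ.toStage13Params (lit F θ hP g₀ os).u3 k) ∧
      N18At (u3OfRecord₁₃ θ.toStage13Params (lit F θ hP g₀ os).u3 k) ∧ N22At (u3OfRecord₁₃ θ.toStage13Params (lit F θ hP g₀ os).u3 k)
    rw [hlit]
    exact ⟨hs, hall k⟩

end Summit.QuantumFields.YangMills.BalabanUVNodes.N17D4ReadOutAtRecord

end
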